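/-
Copyright (c) 2026 the pub-hodgecm-mathlib formalisation cell (harness21).  Prover seat hodgecm-mathlib-K2Liu-p09 (g2): Track B «K2-LIT», #184♮ = hLiu418,
payer-internal step (F) of file #34 `Theorems/K2LiuDoublingZetaGL1.lean` (LEAD F0P6-plan (g10) DEAL K2/STATUS 2026-09-04T02:36:29Z; DEPMAP v2.5 §10 TABLE B
row «the identity»: ★ #31s `IsFactorizableOff` → ★ #29s hypothesis (F)).
-/
import Literature.NumberTheory.K2Lit.LocalDoublingUnramifiedHecke
import Summits.HodgeConjecture.HodgeConjecture.Theorems.K2LiuDoublingZetaGL1Docking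
import HarnessLib

/-!
# Crux `HLiu418`, Track B road `K2_Liu`, file #34 — step (F): ★ #31s's FACTORISATION READ ON `U(H)(𝔸)` THROUGH THE DOCKING

Cell `hodgecm-mathlib`, crux item hLiu418 = `stmt-HodgeConjecture-24832`, route of record `HCCMUnconditional`; squad K2 ∕ K2Liu, LEAD F0P6-plan (g10),
prover K2Liu-p09 (g2).  THEOREMS ONLY (no `def`, no instance, no notation, no named-fact hypothesis, no `sorry`, default heartbeats); lane
`--supports stmt-HodgeConjecture-24832 --as helper` (count-neutral).

★ #31s `K2LiuStdFamilyFactorisable.stdFamilyFactorisable` delivers `IsFactorizableOff S χ f fS` on the doubled group `H(𝔸) = U(hermD)(𝔸)`: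
`f_s(h) = fS_s(h_∞, (h_v)_{v∈S}) · ∏ᶠ_{v∉S} Λ_{s,v}(h_v)`.  ★ #29s `doublingPartialEuler` wants hypothesis (F) for the pulled-back section
`t ↦ f_s(ι(ιA t, 1))` on `G = U(H)(𝔸)` with the components of `t`.  The passage:
* §1 `coe_toMixed_eq_map`, `archPart_iotaV_congr`, `archPart_iotaLeft_congr` — the archimedean part of `ι(g₁, g₂)` depends only on the archimedean
  parts of `g₁, g₂` (★ `coe_iotaV` + ★ `iotaMatrix_map` through the archimedean projection; no archimedean doubling map is DEFINED — only this
  functional dependence is needed);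
* §2 `evalPlace_finPart_iotaLeft` — `(ι(a, 1))_v = ι_v(a_v, 1)` (★ `finPart_iotaV` + ★ `evalPlace_iotaLeftFin`);
* §3 `factorizable_pullback` — **(F) for ★ #29s**: for every `s` there is `FS` with
  `f_s(ι(ιA t, 1)) = FS(t_∞, (t_v)_{v∈S}) · ∏ᶠ_{v∉S} (Λ_{s,v} ∘ ι_v(·,1) ∘ localCongr_v)(t_v)` for all `t ∈ U(H)(𝔸)` (★ `K2LiuDoublingZetaGL1Docking`).

HONEST LABEL: HC_CM is proved only modulo the printed citations (2 remaining named inputs: hLiu418 = stmt-HodgeConjecture-24832,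
h413 = stmt-HodgeConjecture-24833) until rung 0 closes; this file is bookkeeping toward socket s23 and closes no item.
-/

set_option autoImplicit false
set_option linter.dupNamespace false

noncomputable section

open scoped Matrix MatrixGroups Kronecker
open NumberField NumberField.mixedEmbedding IsDedekindDomain Filter

namespace Summit.HodgeConjecture.HodgeConjecture.Cruxes.HLiu418.K2LiuDoublingZetaGL1Factor

open Literature.NumberTheory.Automorphic Literature.NumberTheory.Automorphic.UnitaryGroup
open Literature.NumberTheory.GaloisRepresentations
open Literature.NumberTheory.GelbartRogawski1991 Literature.NumberTheory.GelbartRogawski1991.GRConstruction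
open Literature.NumberTheory.GelbartRogawski1991.UnitaryDualPair
open Literature.NumberTheory.K2Lit.SiegelDoubled
open Summit.HodgeConjecture.HodgeConjecture.Cruxes.HLiu418.K2LiuDoublingZetaGL1Docking

/-! ## §1 The archimedean part of `ι(g₁, g₂)` depends only on the archimedean parts -/

section Arch

variable (L : Type) [Field L] [NumberField L] [IsCMField L]

omit [IsCMField L] in
/-- the matrix of `GLn.toMixed X` is the matrix of `X` read through the archimedean projection `𝔸_L → L ⊗ ℝ` (definitional bookkeeping). [folklore] -/
theorem coe_toMixed_eq_map {K : ℕ} (X : GL (Fin K) (AdeleRing (𝓞 L) L)) :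
    ((GLn.toMixed K L X : GL (Fin K) (mixedSpace L)) : Matrix (Fin K) (Fin K) (mixedSpace L)) =
      ((X : GL (Fin K) (AdeleRing (𝓞 L) L)) : Matrix (Fin K) (Fin K) (AdeleRing (𝓞 L) L)).map
        ((InfiniteAdeleRing.ringEquiv_mixedSpace L).toRingHom.comp (UnitaryGroup.adeleFst L)) := by
  rw [RingHom.coe_comp, ← Matrix.map_map]
  rfl

variable {N M n : ℕ} (e : Fin N × Fin M ≃ Fin n)
  (dV : Fin N → L) (hdV : ∀ i, IsCMField.complexConj L (dV i) = dV i)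
  (dW : Fin M → L) (hdW : ∀ i, IsCMField.complexConj L (dW i) = dW i)

/-- **`(ι(g₁, g₂))_∞` depends only on `(g₁)_∞, (g₂)_∞`**: the matrix of `ι(g₁, g₂)` is the block matrix of `g₁ ⊗ 1, g₂ ⊗ 1` (★ `coe_iotaV`) and the
archimedean projection is a ring homomorphism applied entrywise (★ `iotaMatrix_map`). [cite: HarrisKudlaSweet1996, §1 (1.11)] [cite: BorelJacquet1979, §4.1] -/
theorem archPart_iotaV_congr {g₁ g₂ g₁' g₂' : UnitaryGroup.adelic (Fp L) L (IsCMField.complexConj L) N (Matrix.diagonal dV)}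
    (h₁ : UnitaryGroup.archPart (Fp L) L (IsCMField.complexConj L) N (Matrix.diagonal dV) g₁ =
      UnitaryGroup.archPart (Fp L) L (IsCMField.complexConj L) N (Matrix.diagonal dV) g₁')
    (h₂ : UnitaryGroup.archPart (Fp L) L (IsCMField.complexConj L) N (Matrix.diagonal dV) g₂ =
      UnitaryGroup.archPart (Fp L) L (IsCMField.complexConj L) N (Matrix.diagonal dV) g₂') :
    UnitaryGroup.archPart (Fp L) L (IsCMField.complexConj L) (n + n) (hermD L e dV hdV dW hdW) (iotaV L e dV hdV dW hdW (g₁, g₂)) =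
      UnitaryGroup.archPart (Fp L) L (IsCMField.complexConj L) (n + n) (hermD L e dV hdV dW hdW) (iotaV L e dV hdV dW hdW (g₁', g₂')) := by
  have h₁' := congrArg (fun y : ↥(UnitaryGroup.arch (Fp L) L (IsCMField.complexConj L) N (Matrix.diagonal dV)) =>
    ((y : GL (Fin N) (mixedSpace L)) : Matrix (Fin N) (Fin N) (mixedSpace L))) h₁
  have h₂' := congrArg (fun y : ↥(UnitaryGroup.arch (Fp L) L (IsCMField.complexConj L) N (Matrix.diagonal dV)) =>
    ((y : GL (Fin N) (mixedSpace L)) : Matrix (Fin N) (Fin N) (mixedSpace L))) h₂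
  simp only [UnitaryGroup.coe_archPart, coe_toMixed_eq_map, adelicVal_apply] at h₁' h₂'
  refine Subtype.ext (Units.ext ?_)
  rw [UnitaryGroup.coe_archPart, UnitaryGroup.coe_archPart, coe_toMixed_eq_map, coe_toMixed_eq_map]
  change ((((iotaV L e dV hdV dW hdW (g₁, g₂) : HA L e dV hdV dW hdW) : GL (Fin (n + n)) (AdeleRing (𝓞 L) L)) :
      Matrix (Fin (n + n)) (Fin (n + n)) (AdeleRing (𝓞 L) L))).map _ =
    ((((iotaV L e dV hdV dW hdW (g₁', g₂') : HA L e dV hdV dW hdW) : GL (Fin (n + n)) (AdeleRing (𝓞 L) L)) :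
      Matrix (Fin (n + n)) (Fin (n + n)) (AdeleRing (𝓞 L) L))).map _
  rw [coe_iotaV, coe_iotaV, iotaMatrix_map, iotaMatrix_map]
  dsimp only
  rw [h₁', h₂']

/-- `(ι(a, 1))_∞` depends only on `a_∞`. [cite: HarrisKudlaSweet1996, §1 (1.11)] -/
theorem archPart_iotaLeft_congr {a a' : UnitaryGroup.adelic (Fp L) L (IsCMField.complexConj L) N (Matrix.diagonal dV)}
    (h : UnitaryGroup.archPart (Fp L) L (IsCMField.complexConj L) N (Matrix.diagonal dV) a =
      UnitaryGroup.archPart (Fp L) L (IsCMField.complexConj L) N (Matrix.diagonal dV) a') :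
    UnitaryGroup.archPart (Fp L) L (IsCMField.complexConj L) (n + n) (hermD L e dV hdV dW hdW) (iotaLeft L e dV hdV dW hdW a) =
      UnitaryGroup.archPart (Fp L) L (IsCMField.complexConj L) (n + n) (hermD L e dV hdV dW hdW) (iotaLeft L e dV hdV dW hdW a') := by
  rw [iotaLeft_apply, iotaLeft_apply]
  exact archPart_iotaV_congr L e dV hdV dW hdW h rfl

/-! ## §2 The finite components of `ι(a, 1)` -/

/-- **`(ι(a, 1))_v = ι_v(a_v, 1)`** on ★ `UnitaryGroup.evalPlace ∘ finPart` (★ `finPart_iotaV` + ★ `evalPlace_iotaLeftFin`). [cite: Liu2011, §2C p. 863] -/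
theorem evalPlace_finPart_iotaLeft (v : HeightOneSpectrum (𝓞 (Fp L)))
    (a : UnitaryGroup.adelic (Fp L) L (IsCMField.complexConj L) N (Matrix.diagonal dV)) :
    UnitaryGroup.evalPlace (Fp L) L (IsCMField.complexConj L) (n + n) (hermD L e dV hdV dW hdW) v
        (UnitaryGroup.finPart (Fp L) L (IsCMField.complexConj L) (n + n) (hermD L e dV hdV dW hdW) (iotaLeft L e dV hdV dW hdW a)) =
      iotaLeftLocPi L e dV hdV dW hdW v
        (UnitaryGroup.evalPlace (Fp L) L (IsCMField.complexConj L) N (Matrix.diagonal dV) v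
          (UnitaryGroup.finPart (Fp L) L (IsCMField.complexConj L) N (Matrix.diagonal dV) a)) := by
  have h1 : UnitaryGroup.finPart (Fp L) L (IsCMField.complexConj L) N (Matrix.diagonal dV)
      (1 : ↥(UnitaryGroup.adelic (Fp L) L (IsCMField.complexConj L) N (Matrix.diagonal dV))) = 1 := map_one _
  rw [iotaLeft_apply, finPart_iotaV, h1, ← iotaLeftFin_apply, evalPlace_iotaLeftFin]

end Arch

/-! ## §3 (F) for ★ #29s from ★ #31s's `IsFactorizableOff`, through the docking -/

section Docked

variable (L : Type) [Field L] [NumberField L] [IsCMField L]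
variable {N M n : ℕ} (e : Fin N × Fin M ≃ Fin n) (H : Matrix (Fin N) (Fin N) L)
  (dV : Fin N → L) (hdV : ∀ i, IsCMField.complexConj L (dV i) = dV i)
  (dW : Fin M → L) (hdW : ∀ i, IsCMField.complexConj L (dW i) = dW i)
  (t : L) (ht : t ≠ 0) (g : GL (Fin N) L)
  (hg : formCongr ((IsCMField.complexConj L : L ≃ₐ[↥(maximalRealSubfield L)] L) : L →+* L) g (t • H) = Matrix.diagonal dV)
  (ιA : (adelicGroupData (↥(maximalRealSubfield L)) L (IsCMField.complexConj L) N H).Adelic →*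
    ↥(UnitaryGroup.adelic (↥(maximalRealSubfield L)) L (IsCMField.complexConj L) N (Matrix.diagonal dV)))
  (hιA : ∀ k, ((ιA k : ↥(UnitaryGroup.adelic (↥(maximalRealSubfield L)) L (IsCMField.complexConj L) N (Matrix.diagonal dV))) :
        GL (Fin N) (AdeleRing (𝓞 L) L)) =
      (toAdeleGL L g)⁻¹ * adelicVal (↥(maximalRealSubfield L)) L (IsCMField.complexConj L) N H k * toAdeleGL L g)

include ht hg hιA in
set_option maxHeartbeats 400000 in -- measured: the statement's `whnf` of the docked CM frame exceeds 200000 (fails at default), passes at 400000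
/-- **(F) of ★ #29s `doublingPartialEuler`, from ★ #31s.**  If the family `f` factorises off `S` on `H(𝔸)` (★ `IsFactorizableOff S χ f fS`), then for every `s`
the pulled-back section `x ↦ f_s(ι(ιA x, 1))` on `U(H)(𝔸)` factorises with respect to the components of `x`:
`f_s(ι(ιA x, 1)) = FS(x_∞, (x_v)_{v ∈ S}) · ∏ᶠ_{v ∉ S} Λ_{s,v}(ι_v(localCongr_v(x_v), 1))` for a suitable `FS` (the archimedean slot through §1 and a
chosen archimedean lift, ★ `archPart_surjective`; the finite slots through §2 and ★ `K2LiuDoublingZetaGL1Docking.evalPlace_finPart_iotaA`).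
[cite: Liu2011, §2B p. 862] [cite: GelbartPiatetskishapiroRallis1987, Part A §1] -/
theorem factorizable_pullback (S : Finset (HeightOneSpectrum (𝓞 (Fp L)))) (χ : HeckeCharacter L) (f : ℂ → HA L e dV hdV dW hdW → ℂ)
    (fS : ℂ → UnitaryGroup.arch (Fp L) L (IsCMField.complexConj L) (n + n) (hermD L e dV hdV dW hdW) ×
      (Π v : S, UnitaryGroup.localPi L (IsCMField.complexConj L) (n + n) (hermD L e dV hdV dW hdW) v.1) → ℂ)
    (hfac : IsFactorizableOff L e dV hdV dW hdW S χ f fS) (s : ℂ) :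
    ∃ FS : UnitaryGroup.arch (Fp L) L (IsCMField.complexConj L) N H ×
        (Π v : S, UnitaryGroup.localPi L (IsCMField.complexConj L) N H v.1) → ℂ,
      ∀ x : (adelicGroupData (↥(maximalRealSubfield L)) L (IsCMField.complexConj L) N H).Adelic,
        f s (iotaLeft L e dV hdV dW hdW (ιA x)) =
          FS (UnitaryGroup.archPart (Fp L) L (IsCMField.complexConj L) N H x,
              fun v : S => UnitaryGroup.evalPlace (Fp L) L (IsCMField.complexConj L) N H v.1
                (UnitaryGroup.finPart (Fp L) L (IsCMField.complexConj L) N H x)) *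
            ∏ᶠ v : {v : HeightOneSpectrum (𝓞 (Fp L)) // v ∉ S},
              LambdaLoc L e dV hdV dW hdW v.1 χ s
                (iotaLeftLocPi L e dV hdV dW hdW v.1
                  (localCongr L (IsCMField.complexConj L) g⁻¹ (inv_ne_zero ht) (formCongr_inv_diagonal L H dV t ht g hg) v.1
                    (UnitaryGroup.evalPlace (Fp L) L (IsCMField.complexConj L) N H v.1
                      (UnitaryGroup.finPart (Fp L) L (IsCMField.complexConj L) N H x)))) := by
  classical
  obtain ⟨Φi, -, hΦi⟩ := exists_archCongr_archPart_iotaA L H dV t ht g hg ιA hιA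
  refine ⟨fun p => fS s
      (UnitaryGroup.archPart (Fp L) L (IsCMField.complexConj L) (n + n) (hermD L e dV hdV dW hdW)
              (iotaLeft L e dV hdV dW hdW (ιA (Classical.choose
                (UnitaryGroup.archPart_surjective (Fp L) L (IsCMField.complexConj L) N H p.1)))),
        fun v : S => iotaLeftLocPi L e dV hdV dW hdW v.1 (localCongr L (IsCMField.complexConj L) g⁻¹ (inv_ne_zero ht) (formCongr_inv_diagonal L H dV t ht g hg) v.1 (p.2 v))), fun x => ?_⟩
  -- the archimedean slot: any lift of `x_∞` gives the same `(ι(ιA ·, 1))_∞`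
  have harch : UnitaryGroup.archPart (Fp L) L (IsCMField.complexConj L) (n + n) (hermD L e dV hdV dW hdW)
        (iotaLeft L e dV hdV dW hdW (ιA x)) =
      UnitaryGroup.archPart (Fp L) L (IsCMField.complexConj L) (n + n) (hermD L e dV hdV dW hdW)
              (iotaLeft L e dV hdV dW hdW (ιA (Classical.choose
                (UnitaryGroup.archPart_surjective (Fp L) L (IsCMField.complexConj L) N H (UnitaryGroup.archPart (Fp L) L (IsCMField.complexConj L) N H x))))) := by
    refine archPart_iotaLeft_congr L e dV hdV dW hdW ?_
    rw [hΦi, hΦi, Classical.choose_spec (UnitaryGroup.archPart_surjective (Fp L) L (IsCMField.complexConj L) N H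
      (UnitaryGroup.archPart (Fp L) L (IsCMField.complexConj L) N H x))]
  -- the finite slots
  have hcomp : ∀ v : HeightOneSpectrum (𝓞 (Fp L)),
      UnitaryGroup.evalPlace (Fp L) L (IsCMField.complexConj L) (n + n) (hermD L e dV hdV dW hdW) v
          (UnitaryGroup.finPart (Fp L) L (IsCMField.complexConj L) (n + n) (hermD L e dV hdV dW hdW)
            (iotaLeft L e dV hdV dW hdW (ιA x))) =
        iotaLeftLocPi L e dV hdV dW hdW v
          (localCongr L (IsCMField.complexConj L) g⁻¹ (inv_ne_zero ht) (formCongr_inv_diagonal L H dV t ht g hg) v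
            (UnitaryGroup.evalPlace (Fp L) L (IsCMField.complexConj L) N H v
              (UnitaryGroup.finPart (Fp L) L (IsCMField.complexConj L) N H x))) := by
    intro v
    rw [evalPlace_finPart_iotaLeft, evalPlace_finPart_iotaA L H dV t ht g hg ιA hιA x v]
  have hf := hfac s (iotaLeft L e dV hdV dW hdW (ιA x))
  rw [hf]
  congr 1
  · show fS s _ = fS s _
    congr 1
    exact Prod.ext harch (funext fun v => hcomp v.1)
  · exact finprod_congr fun v => by rw [hcomp v.1]

end Docked

end Summit.HodgeConjecture.HodgeConjecture.Cruxes.HLiu418.K2LiuDoublingZetaGL1Factor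

end
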